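import Mathlib.Analysis.Complex.Basic
import Literature.Analysis.ValidatedNumerics.KernelData
import Literature.Analysis.ValidatedNumerics.QuadFormEnclosure
import HarnessLib

/-!
# Kernel-checkable certificates for interval families of symmetric / Hermitian forms

Topic `Literature/Analysis/ValidatedNumerics`. The CHECKER layer of the generic eigen-enclosure
infrastructure: closed Boolean functions of literal rational data (lists, lists of rows — the
format a compute job emits as JSON and a script prints as a Lean term) whose truth, established
by `decide` / `decide +kernel` / `native_decide`, implies bounds valid for EVERY matrix of an
entrywise interval family. Soundness is reduced to the algebra of `QuadFormEnclosure.lean`.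
The matrix-level consequences (`Matrix.IsHermitian.eigenvalues`, `dotProduct`/`mulVec` forms on
`Fin n`) are in `MatrixEigenEnclosure.lean`.

## Certificate format

* the CLAIM data: `n`, a centre `C : List (List ℚ)` (`n` rows of `n`), radii `Δ : List (List ℚ)`;
  for complex Hermitian families two centre tables `Cre`, `Cim` (real and imaginary parts);
  the family is `{A | |A i j − C i j| ≤ Δ i j}` (real) resp. `{H | ‖H i j − (Cre + i Cim) i j‖ ≤ Δ i j}`;
* a LOWER certificate `LDLCert = ⟨lam, k, L, D⟩`: the claimed bound `lam : ℚ`, a factor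
  `L : List (List ℚ)` (`n` rows of `k`; `2n` rows for the Hermitian check) and weights
  `D : List ℚ` (`k` entries, `≥ 0`) — typically a rounded `LDLᵀ`/Cholesky factorisation of
  `C − lam·I` computed in floating point and rounded to a dyadic grid; `k = 0` is the pure
  Gershgorin check;
* an UPPER certificate: a rational test vector `u : List ℚ` (two lists `ure`, `uim` in the
  Hermitian case) and the claimed Rayleigh bound `μ : ℚ`.

## Checkers and soundness

* `checkLower n C Δ c` ⇒ (`mul_sqSum_le_quadForm_of_checkLower`) for every real `A` with
  `|A i j − C i j| ≤ Δ i j` (`i, j < n`) and every `x`: `lam · Σ x i² ≤ xᵀ A x`;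
* `checkLowerHerm n Cre Cim Δ c` (the real `2n × 2n` embedding) ⇒
  (`mul_normSq_le_re_hermForm_of_checkLowerHerm`) for every complex `H` with
  `‖H i j − (Cre i j + Cim i j · I)‖ ≤ Δ i j` and every `z`: `lam · Σ ‖z i‖² ≤ re (z* H z)` — no
  Hermitian symmetry is needed for this inequality; for Hermitian `H` it is the eigenvalue bound;
* `checkUpper n C Δ u μ` ⇒ (`quadForm_le_mul_sqSum_of_checkUpper`) `uᵀ A u ≤ μ · Σ u i²` and
  `0 < Σ u i²` for every `A` of the family; `checkUpperHerm` likewise for complex families.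

Three closing `example`s evaluate the checkers in the kernel on `2 × 2` data.

## Emitting certificates (recipe for the compute lane; mirrored by a pure-Python reference emitter)

1. Enclose the entries: rational centre `C` (`Cre`, `Cim`) and radii `Δ` (dyadic, e.g. 2⁻²⁰·ℤ).
2. `ρ := max_i Σ_j (Δ i j + Δ j i)/2` (for the Hermitian check, of the embedded `2n × 2n` radii,
   i.e. twice the `n × n` row sums); float `λ_min(C)` and a unit eigenvector `v`.
3. Lower: `lam := λ_min(C) − ρ − s` (slack `s ≈ 10⁻⁹‖C‖n`); float Cholesky `C − (lam + ρ + s/2) I = L Lᵀ`;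
   round `L` to `p`-bit dyadics (`p = 30` is ample), `D := [1, …, 1]`, `k := n` (`2n`), `lam`
   rounded DOWN to the grid; re-run `checkLower` exactly in rationals; on failure multiply `s` by 4.
   (Any `L`, `D ≥ 0` is sound — pivoted `LDLᵀ`, low-rank factors `k < n`, or `k = 0` = Gershgorin.)
4. Upper: `u :=` dyadic rounding of `v`; `μ := ⌈(uᵀCu + Σ Δ i j |u i||u j|)/uᵀu⌉_grid`.
5. Print `theorem foo : checkLower n C Δ ⟨lam, k, L, D⟩ = true := by decide +kernel` (lists of
   `ℚ` literals `p/q`). Measured kernel cost of `decide +kernel` at 30-bit data, `k = n`, dense: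
   `n = 12`: < 1 s, `n = 20`: ≈ 6 s, `n = 30`: ≈ 22 s (growth ≈ n³); use `native_decide` beyond
   `n ≈ 40`, or split block-diagonal structure into several certificates.

## References

* S. M. Rump, *Verification methods: rigorous results using floating-point arithmetic*, Acta
  Numerica 19 (2010), §10.8 (verified positive definiteness: floating Cholesky factor of the
  shifted midpoint matrix plus a perturbation/residual bound covering the whole interval
  matrix). [folklore]
-/

open Finset

namespace Literature.Analysis.ValidatedNumerics

/-! ### The lower certificate and its checker -/

/-- A lower eigen-enclosure certificate: the claimed bound `lam`, and an `n × k` factor `L` with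
`k` non-negative weights `D` such that `C − lam·I − L·diag(D)·Lᵀ` is diagonally dominant with room
for the radii. [folklore] -/
structure LDLCert where
  /-- the certified lower bound of the form (shift) -/
  lam : ℚ
  /-- number of columns of the factor -/
  k : ℕ
  /-- the factor, `n` rows of `k` rationals -/
  L : List (List ℚ)
  /-- the `k` weights (must be `≥ 0`) -/
  D : List ℚ
  deriving DecidableEq, Inhabited

/-- The rational residual `R i j = C i j − Σ_{m<k} L i m D m L j m − lam δ_{ij}`. [folklore] -/
def residualQ (c : LDLCert) (C : List (List ℚ)) (i j : ℕ) : ℚ :=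
  mget C i j - rsum c.k (fun m ↦ mget c.L i m * vget c.D m * mget c.L j m) -
    if i = j then c.lam else 0

/-- The symmetrised Gershgorin radius of a tabulated rational matrix. [folklore] -/
def offDiagQ (n : ℕ) (R : List (List ℚ)) (i : ℕ) : ℚ :=
  rsum n fun j ↦ if j = i then 0 else (|mget R i j| + |mget R j i|) / 2

/-- The symmetrised row sum of a tabulated radius matrix. [folklore] -/
def radRowQ (n : ℕ) (Δ : List (List ℚ)) (i : ℕ) : ℚ :=
  rsum n fun j ↦ (mget Δ i j + mget Δ j i) / 2

/-- **The lower checker**: `D ≥ 0` and, with `R = C − L D Lᵀ − lam I` tabulated once,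
`offDiag R i + radRow Δ i ≤ R i i` for every `i < n`. [folklore] -/
def checkLower (n : ℕ) (C Δ : List (List ℚ)) (c : LDLCert) : Bool :=
  let R := mtab n n (residualQ c C)
  rall c.k (fun m ↦ decide (0 ≤ vget c.D m)) &&
    rall n (fun i ↦ decide (offDiagQ n R i + radRowQ n Δ i ≤ mget R i i))

/-- Real reading of a rational table. [folklore] -/
def mreal (A : List (List ℚ)) (i j : ℕ) : ℝ := ((mget A i j : ℚ) : ℝ)

/-- Real reading of a rational list. [folklore] -/
def vreal (v : List ℚ) (i : ℕ) : ℝ := ((vget v i : ℚ) : ℝ)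

/-- The rational residual is the real residual of the cast data. [folklore] -/
theorem cast_residualQ (c : LDLCert) (C : List (List ℚ)) (i j : ℕ) :
    ((residualQ c C i j : ℚ) : ℝ) = residual c.k (mreal C) (mreal c.L) (vreal c.D) c.lam i j := by
  unfold residualQ residual ldlt mreal vreal
  rw [rsum_eq_sum]
  by_cases hij : i = j
  · subst hij; push_cast; simp
  · simp only [hij, ↓reduceIte]; push_cast; ring

/-- Cast of `offDiagQ`. [folklore] -/
theorem cast_offDiagQ (n : ℕ) (R : List (List ℚ)) (i : ℕ) :
    ((offDiagQ n R i : ℚ) : ℝ) = offDiag n (mreal R) i := by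
  unfold offDiagQ offDiag mreal
  rw [rsum_eq_sum]
  push_cast [apply_ite ((↑) : ℚ → ℝ)]
  rfl

/-- Cast of `radRowQ`. [folklore] -/
theorem cast_radRowQ (n : ℕ) (Δ : List (List ℚ)) (i : ℕ) :
    ((radRowQ n Δ i : ℚ) : ℝ) = radRow n (mreal Δ) i := by
  unfold radRowQ radRow mreal
  rw [rsum_eq_sum]
  push_cast
  rfl

/-- The tabulated residual read in `ℝ` is the real residual (on the block). [folklore] -/
theorem mreal_mtab_residualQ {n : ℕ} (c : LDLCert) (C : List (List ℚ)) {i j : ℕ} (hi : i < n)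
    (hj : j < n) :
    mreal (mtab n n (residualQ c C)) i j = residual c.k (mreal C) (mreal c.L) (vreal c.D) c.lam i j := by
  show ((mget (mtab n n (residualQ c C)) i j : ℚ) : ℝ) = _
  rw [mget_mtab _ hi hj, cast_residualQ]

/-- **Soundness of the lower checker.** If `checkLower n C Δ c = true` then for every real matrix
`A` with `|A i j − C i j| ≤ Δ i j` for `i, j < n` and every `x`: `lam · Σ_{i<n} x i² ≤ xᵀ A x`.
[folklore] -/
theorem mul_sqSum_le_quadForm_of_checkLower {n : ℕ} {C Δ : List (List ℚ)} {c : LDLCert}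
    (h : checkLower n C Δ c = true) {A : ℕ → ℕ → ℝ}
    (hA : ∀ i ∈ range n, ∀ j ∈ range n, |A i j - mreal C i j| ≤ mreal Δ i j) (x : ℕ → ℝ) :
    (c.lam : ℝ) * sqSum n x ≤ quadForm n A x := by
  unfold checkLower at h
  simp only [Bool.and_eq_true] at h
  obtain ⟨hD, hdom⟩ := h
  refine mul_sqSum_le_quadForm_of_residual (k := c.k) (L := mreal c.L) (D := vreal c.D)
    (fun m hm ↦ ?_) hA (fun i hi ↦ ?_) x
  · have h1 := of_rall_mem hD hm
    rw [decide_eq_true_eq] at h1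
    show (0 : ℝ) ≤ ((vget c.D m : ℚ) : ℝ)
    exact_mod_cast h1
  · have hi' := mem_range.1 hi
    have h1 := of_rall hdom hi'
    rw [decide_eq_true_eq, mget_mtab _ hi' hi'] at h1
    have h2 : ((offDiagQ n (mtab n n (residualQ c C)) i : ℚ) : ℝ) + ((radRowQ n Δ i : ℚ) : ℝ) ≤
        ((residualQ c C i i : ℚ) : ℝ) := by exact_mod_cast h1
    rwa [cast_offDiagQ, cast_radRowQ, cast_residualQ,
      offDiag_congr (fun i hi j hj ↦ mreal_mtab_residualQ c C hi hj) hi'] at h2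

/-! ### Complex Hermitian families: the real embedding of the data -/

/-- The tabulated real `2n × 2n` embedding `[[Cre, −Cim], [Cim, Cre]]` of a complex centre.
[folklore] -/
def embedC (n : ℕ) (Cre Cim : List (List ℚ)) : List (List ℚ) :=
  mtab (2 * n) (2 * n) fun i j ↦
    if i < n then (if j < n then mget Cre i j else -mget Cim i (j - n))
    else (if j < n then mget Cim (i - n) j else mget Cre (i - n) (j - n))

/-- The tabulated radii of the real embedding (the radius table repeated in the four blocks).
[folklore] -/
def embedRad (n : ℕ) (Δ : List (List ℚ)) : List (List ℚ) :=
  mtab (2 * n) (2 * n) fun i j ↦ mget Δ (if i < n then i else i - n) (if j < n then j else j - n)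

/-- **The lower checker for complex Hermitian families**: the real checker on the embedded data
(`c.L` has `2n` rows). [folklore] -/
def checkLowerHerm (n : ℕ) (Cre Cim Δ : List (List ℚ)) (c : LDLCert) : Bool :=
  checkLower (2 * n) (embedC n Cre Cim) (embedRad n Δ) c

/-- The complex centre matrix `Cre + i Cim` read as a function. [folklore] -/
def centreC (Cre Cim : List (List ℚ)) (i j : ℕ) : ℂ :=
  (mreal Cre i j : ℂ) + (mreal Cim i j : ℂ) * Complex.I

/-- The embedded table is the real embedding of the complex centre. [folklore] -/
theorem mreal_embedC {n : ℕ} (Cre Cim : List (List ℚ)) {i j : ℕ} (hi : i < 2 * n) (hj : j < 2 * n) :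
    mreal (embedC n Cre Cim) i j = realEmb n (centreC Cre Cim) i j := by
  unfold mreal embedC realEmb centreC
  rw [mget_mtab _ hi hj]
  unfold mreal
  split_ifs <;> simp

/-- The embedded radius table is `realRad` of the radii. [folklore] -/
theorem mreal_embedRad {n : ℕ} (Δ : List (List ℚ)) {i j : ℕ} (hi : i < 2 * n) (hj : j < 2 * n) :
    mreal (embedRad n Δ) i j = realRad n (mreal Δ) i j := by
  unfold mreal embedRad realRad
  rw [mget_mtab _ hi hj]

/-- **Soundness of the Hermitian lower checker.** If `checkLowerHerm n Cre Cim Δ c = true` then for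
every complex matrix `H` with `‖H i j − (Cre i j + Cim i j · I)‖ ≤ Δ i j` (`i, j < n`) and every
`z`: `lam · Σ_{i<n} ‖z i‖² ≤ re (Σ_{i,j<n} conj(z i) H i j z j)`. [folklore] -/
theorem mul_normSq_le_re_hermForm_of_checkLowerHerm {n : ℕ} {Cre Cim Δ : List (List ℚ)}
    {c : LDLCert} (h : checkLowerHerm n Cre Cim Δ c = true) {H : ℕ → ℕ → ℂ}
    (hH : ∀ i ∈ range n, ∀ j ∈ range n, ‖H i j - centreC Cre Cim i j‖ ≤ mreal Δ i j) (z : ℕ → ℂ) :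
    (c.lam : ℝ) * ∑ i ∈ range n, ‖z i‖ ^ 2 ≤
      RCLike.re (∑ i ∈ range n, ∑ j ∈ range n, star (z i) * H i j * z j) := by
  rw [re_hermForm_eq_quadForm, ← sqSum_realVec]
  refine mul_sqSum_le_quadForm_of_checkLower h (fun i hi j hj ↦ ?_) _
  have hi' := mem_range.1 hi
  have hj' := mem_range.1 hj
  rw [mreal_embedC _ _ hi' hj', mreal_embedRad _ hi' hj']
  exact abs_realEmb_sub_le hH i hi j hj

/-! ### The upper (test-vector) checker -/

/-- The rational quadratic form `uᵀ C u` of tabulated data. [folklore] -/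
def quadFormQ (n : ℕ) (C : List (List ℚ)) (u : List ℚ) : ℚ :=
  rsum n fun i ↦ rsum n fun j ↦ mget C i j * (vget u i * vget u j)

/-- The rational radius form `Σ Δ i j |u i| |u j|`. [folklore] -/
def radFormQ (n : ℕ) (Δ : List (List ℚ)) (u : List ℚ) : ℚ :=
  rsum n fun i ↦ rsum n fun j ↦ mget Δ i j * (|vget u i| * |vget u j|)

/-- `Σ_{i<n} (u i)²` of a rational list. [folklore] -/
def sqSumQ (n : ℕ) (u : List ℚ) : ℚ := rsum n fun i ↦ vget u i ^ 2

/-- **The upper checker**: the test vector is non-zero on the block and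
`uᵀ C u + Σ Δ i j |u i||u j| ≤ μ · Σ u i²`. [folklore] -/
def checkUpper (n : ℕ) (C Δ : List (List ℚ)) (u : List ℚ) (μ : ℚ) : Bool :=
  decide (0 < sqSumQ n u) && decide (quadFormQ n C u + radFormQ n Δ u ≤ μ * sqSumQ n u)

/-- Cast of `sqSumQ`. [folklore] -/
theorem cast_sqSumQ (n : ℕ) (u : List ℚ) : ((sqSumQ n u : ℚ) : ℝ) = sqSum n (vreal u) := by
  unfold sqSumQ sqSum vreal
  rw [rsum_eq_sum]
  push_cast
  rfl

/-- Cast of `quadFormQ`. [folklore] -/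
theorem cast_quadFormQ (n : ℕ) (C : List (List ℚ)) (u : List ℚ) :
    ((quadFormQ n C u : ℚ) : ℝ) = quadForm n (mreal C) (vreal u) := by
  unfold quadFormQ quadForm mreal vreal
  rw [rsum_eq_sum]
  simp_rw [rsum_eq_sum]
  push_cast
  rfl

/-- Cast of `radFormQ`. [folklore] -/
theorem cast_radFormQ (n : ℕ) (Δ : List (List ℚ)) (u : List ℚ) :
    ((radFormQ n Δ u : ℚ) : ℝ) =
      ∑ i ∈ range n, ∑ j ∈ range n, mreal Δ i j * (|vreal u i| * |vreal u j|) := by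
  unfold radFormQ mreal vreal
  rw [rsum_eq_sum]
  simp_rw [rsum_eq_sum]
  push_cast
  rfl

/-- **Soundness of the upper checker.** If `checkUpper n C Δ u μ = true` then the rational test
vector `u` is non-zero on the block and `uᵀ A u ≤ μ · Σ_{i<n} u i²` for every real `A` with
`|A i j − C i j| ≤ Δ i j` (`i, j < n`). [folklore] -/
theorem quadForm_le_mul_sqSum_of_checkUpper {n : ℕ} {C Δ : List (List ℚ)} {u : List ℚ} {μ : ℚ}
    (h : checkUpper n C Δ u μ = true) {A : ℕ → ℕ → ℝ}
    (hA : ∀ i ∈ range n, ∀ j ∈ range n, |A i j - mreal C i j| ≤ mreal Δ i j) :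
    0 < sqSum n (vreal u) ∧ quadForm n A (vreal u) ≤ (μ : ℝ) * sqSum n (vreal u) := by
  unfold checkUpper at h
  simp only [Bool.and_eq_true, decide_eq_true_eq] at h
  obtain ⟨h0, h1⟩ := h
  have h0' : ((0 : ℚ) : ℝ) < ((sqSumQ n u : ℚ) : ℝ) := by exact_mod_cast h0
  have h1' : ((quadFormQ n C u + radFormQ n Δ u : ℚ) : ℝ) ≤ ((μ * sqSumQ n u : ℚ) : ℝ) := by
    exact_mod_cast h1
  push_cast at h0' h1'
  rw [cast_sqSumQ] at h0' h1'
  rw [cast_quadFormQ, cast_radFormQ] at h1'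
  exact ⟨h0', (quadForm_le_quadForm_add_rad hA _).trans h1'⟩

/-- The real `2n`-vector `(ure, uim)` of a complex test vector, tabulated. [folklore] -/
def embedV (n : ℕ) (ure uim : List ℚ) : List ℚ :=
  vtab (2 * n) fun i ↦ if i < n then vget ure i else vget uim (i - n)

/-- The complex test vector `ure + i uim` read as a function. [folklore] -/
def testC (ure uim : List ℚ) (i : ℕ) : ℂ := (vreal ure i : ℂ) + (vreal uim i : ℂ) * Complex.I

/-- The embedded test vector is `realVec` of the complex test vector. [folklore] -/
theorem vreal_embedV {n : ℕ} (ure uim : List ℚ) {i : ℕ} (hi : i < 2 * n) :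
    vreal (embedV n ure uim) i = realVec n (testC ure uim) i := by
  unfold vreal embedV realVec testC
  rw [vget_vtab _ hi]
  unfold vreal
  split_ifs <;> simp

/-- **The upper checker for complex Hermitian families.** [folklore] -/
def checkUpperHerm (n : ℕ) (Cre Cim Δ : List (List ℚ)) (ure uim : List ℚ) (μ : ℚ) : Bool :=
  checkUpper (2 * n) (embedC n Cre Cim) (embedRad n Δ) (embedV n ure uim) μ

/-- **Soundness of the Hermitian upper checker**: the complex test vector `u = ure + i·uim` is
non-zero on the block and `re (u* H u) ≤ μ · Σ ‖u i‖²` for every complex `H` with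
`‖H i j − (Cre i j + Cim i j · I)‖ ≤ Δ i j` (`i, j < n`). [folklore] -/
theorem re_hermForm_le_mul_normSq_of_checkUpperHerm {n : ℕ} {Cre Cim Δ : List (List ℚ)}
    {ure uim : List ℚ} {μ : ℚ} (h : checkUpperHerm n Cre Cim Δ ure uim μ = true) {H : ℕ → ℕ → ℂ}
    (hH : ∀ i ∈ range n, ∀ j ∈ range n, ‖H i j - centreC Cre Cim i j‖ ≤ mreal Δ i j) :
    0 < ∑ i ∈ range n, ‖testC ure uim i‖ ^ 2 ∧
      RCLike.re (∑ i ∈ range n, ∑ j ∈ range n,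
          star (testC ure uim i) * H i j * testC ure uim j) ≤
        (μ : ℝ) * ∑ i ∈ range n, ‖testC ure uim i‖ ^ 2 := by
  have hA : ∀ i ∈ range (2 * n), ∀ j ∈ range (2 * n),
      |realEmb n H i j - mreal (embedC n Cre Cim) i j| ≤ mreal (embedRad n Δ) i j := by
    intro i hi j hj
    have hi' := mem_range.1 hi
    have hj' := mem_range.1 hj
    rw [mreal_embedC _ _ hi' hj', mreal_embedRad _ hi' hj']
    exact abs_realEmb_sub_le hH i hi j hj
  obtain ⟨h0, h1⟩ := quadForm_le_mul_sqSum_of_checkUpper h hA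
  have hv : ∀ i < 2 * n, vreal (embedV n ure uim) i = realVec n (testC ure uim) i :=
    fun i hi ↦ vreal_embedV _ _ hi
  rw [sqSum_congr hv, sqSum_realVec] at h0 h1
  rw [quadForm_congr (fun i _ j _ ↦ rfl) hv, ← re_hermForm_eq_quadForm] at h1
  exact ⟨h0, h1⟩

/-! ### Kernel examples -/

/-- `[[2, 1], [1, 2]] ± 1/10` entrywise: every such matrix satisfies `xᵀ A x ≥ (4/5)‖x‖²`
(pure Gershgorin, `k = 0`), checked by the kernel. -/
example : checkLower 2 [[2, 1], [1, 2]] [[1/10, 1/10], [1/10, 1/10]] ⟨4/5, 0, [], []⟩ = true := by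
  decide +kernel

/-- Where Gershgorin gives nothing (`C = [[1, 1], [1, 6/5]]`, exact data, `λ_min ≈ 0.095`), the
`LDLᵀ` factor of `C − (9/100) I` (`L = [[1], [100/91]]`, `D = [91/100]`) certifies
`xᵀ C x ≥ (9/100)‖x‖²`, checked by the kernel. -/
example : checkLower 2 [[1, 1], [1, 6/5]] [[0, 0], [0, 0]] ⟨9/100, 1, [[1], [100/91]], [91/100]⟩ = true := by
  decide +kernel

/-- Upper check: the test vector `(1, -1)` has Rayleigh quotient `1` for the centre, `≤ 6/5` on the
whole family. -/
example : checkUpper 2 [[2, 1], [1, 2]] [[1/10, 1/10], [1/10, 1/10]] [1, -1] (6/5) = true := by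
  decide +kernel

end Literature.Analysis.ValidatedNumerics
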